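import Literature.Computability.FineGrained.CliqueETH
import Literature.Computability.FineGrained.KSatExponentGap
import Literature.Computability.Complexity.TM2PassThrough
import HarnessLib

/-!
# ETH-hardness of `k`-Clique (Chen–Huang–Kanj–Xia 2006, Thm. 5.5): the route through the
Turing-machine sparsification lemma

This file continues `CliqueETH.lean` (the decomposition of the named fact
`Literature.Computability.FineGrained.not_kClique_inTimeInst_of_eth`, **fine-grained.S23**: assuming ETH, `k`-Clique has
no `f(k) · n^{o(k)}`-time word-RAM algorithm; Chen–Huang–Kanj–Xia, JCSS 72 (2006), Thm. 5.5) with a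
second assembly that moves the change of machine model *below* the sparsification lemma, so that
the sparsification lemma is only ever needed on multi-stack Turing machines — where it is Wave0's
named fact `sparsification` (Impagliazzo–Paturi–Zane, JCSS 63 (2001), Thm. 1 / Cor. 1), whose
combinatorial half is proved in `Sparsification.lean` — and never on the word RAM.

The target is `ETH → ¬ KCliqueInTimeNLittleOK`; contrapositively, an `f(k) · N^{o(k)}` word-RAM
clique algorithm must yield, for every `δ > 0`, a `Turing.FinTM2` deciding 3-SAT in time
`2^{δ n} · poly(L)` (`KSATInExpTime 3 δ`). The chain proved here is

1. (word RAM, proved in `CliqueETHGroupingReduction.lean` / `CliqueETHLiberalReduction.lean`)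
   the grouping reduction of Chen–Huang–Kanj–Xia (Lemma 2.2 / Thm. 5.5): the clique algorithm
   decides *sparse* 3-CNFs (`m ≤ c · n` clauses) on the word RAM in time `O(2^{δ n})`, for every
   density `c` and every `δ > 0` — in the *liberal* form `LiberalSparseKSATInRAMTime` below
   (clause lists with repetitions allowed, every word size from `k' · (n + width)` on), which is
   what the reduction program actually delivers;
2. (the change of machine model, named fact `sparseKSATInExpTime_of_liberalSparseKSATInRAMTime`)
   a word-RAM decider for sparse `k`-SAT running in time `O(2^{δ n})` for every `δ > 0` is
   simulated by a multi-stack Turing machine deciding sparse `k`-CNFs in time `2^{δ n} · poly(L)`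
   for every `δ > 0` (`SparseKSATInExpTime`; folklore, Cook–Reckhow 1973, §2: random-access
   machines are simulated by multitape Turing machines with polynomial overhead);
3. (Turing machines, proved here from `sparsification`: `kSATInExpTime_of_sparseKSATInExpTime`)
   Corollary 2 of Impagliazzo–Paturi–Zane: `k`-SAT with parameter `n` SERF-reduces to sparse
   `k`-SAT — sparsify with `ε = δ/3` (Wave0's `sparsification`), run the sparse decider with
   exponent `δ/3` on each of the `≤ 2^{δ n/3}` produced formulas (each on the same `n` variables
   with `≤ C n` clauses, hence of encoding length `O_{C,k}(n²)`, a factor absorbed by the third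
   `2^{δ n/3}`) and accept iff one of them is accepted (`computesInTime_any`, the list-disjunction
   machine of `TM2AnyList.lean`);

and the **assembly** `not_kClique_inTimeInst_of_eth_of_tm`: `sparsification`, the machine-model
fact (2) and the liberal word-RAM form of the grouping reduction (1) imply
`not_kClique_inTimeInst_of_eth` verbatim. Compared with the first assembly
(`not_kClique_inTimeInst_of_eth_of_sparse` of `CliqueETH.lean`, through `ethWordRAM_of_eth` and
`kSATInRAMTime_of_sparseKSATInRAMTime`) no word-RAM implementation of the algorithm `Reduce` of
Impagliazzo–Paturi–Zane is needed; the only machine-level ingredient left is the interpreter of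
word-RAM programs on `Turing.FinTM2` behind (2).

## Design notes

* `LiberalSparseKSATInRAMTime k c δ` quantifies over clause lists `φ : CNF ℕ` of width `≤ k`
  with `numClauses φ ≤ c · numVars φ`, repetitions allowed (the grouping reduction never uses
  `List.Nodup`, which `kSATProblem k` imposes), over the input `encodeCNFWords φ` of `CNFSAT`, and
  over *every* word size `W ≥ k' · (numVars φ + inputWidth (encodeCNFWords φ))` (the reduction
  program only needs its data to fit into words; a Turing machine simulating the run may thus
  choose any conveniently computable admissible `W`). Accepted outputs are those of `CNFSAT`
  (`[1]`/`[0]`).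
* `SparseKSATInExpTime k c δ` is `KSATInExpTime k δ` with the machine's obligation (correct answer
  within `T(n, L) = O(2^{δ n} poly(L))` steps) restricted to the `k`-CNFs with at most `c · n`
  clauses (`SparseKCNF k c`), exactly as `SparseKSATInRAMTime` restricts `KSATInRAMTime`.
* The machine-model fact (2) is stated qualitatively (every exponent on the RAM gives every
  exponent on the TM) and for `k ≥ 2`: the simulating machine pads its input with the
  tautological clause `x_{n-1} ∨ ¬x_{n-1}` so that the clause list handed to the RAM has exactly
  `n` variables in the sense of `CNF.numVars` (density `≤ (c + 1) n`), which needs width `2`.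

## References

* J. Chen, X. Huang, I. A. Kanj, G. Xia, *Strong computational lower bounds via parameterized
  complexity*, JCSS 72 (2006) 1346–1367, Lemma 2.2, Thms. 3.4, 4.5, 5.3, 5.5.
* R. Impagliazzo, R. Paturi, F. Zane, *Which problems have strongly exponential complexity?*,
  JCSS 63 (2001) 512–530, §2: Thm. 1, Cor. 1 (sparsification), Cor. 2 (SERF-reduction to sparse
  `k`-SAT).
* S. A. Cook, R. A. Reckhow, *Time bounded random access machines*, JCSS 7 (1973) 354–375, §2
  (simulation of RAMs by multitape Turing machines).
* B. Korte, J. Vygen, *Combinatorial Optimization*, Springer 2002, §15.2, p. 341 (an algorithm with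
  random access to binary variables is simulated by a two-tape Turing machine, each elementary
  operation by a scan of the tape holding all variables).
* S. Arora, B. Barak, *Computational Complexity: A Modern Approach*, CUP 2009, §1.3 (machine
  composition).
-/

namespace Literature.Computability.FineGrained

open _root_.Computability Turing Real Filter Topology Cryptography Cryptography.WordRAM

/-! ### Sparse `k`-SAT on the word RAM, liberal form -/

/-- `LiberalSparseKSATInRAMTime k c δ`: some deterministic oracle-free word-RAM program decides
satisfiability of every clause list `φ : CNF ℕ` of width `≤ k` with `numClauses φ ≤ c · numVars φ`
(repeated clauses allowed), given as the `CNFSAT` input `encodeCNFWords φ`, with every word size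
`W ≥ k' · (numVars φ + inputWidth (encodeCNFWords φ))`, within `⌊C · 2^{δ n} + C⌋₊` steps
(`n = numVars φ`), answering `[1]`/`[0]` (`CNFSAT.Good`). This is `SparseKSATInRAMTime k c δ` of
`CliqueETH.lean` without the restriction to `List.Nodup` clause lists and for all admissible word
sizes instead of exactly `k' · (n + width)` — the form in which the grouping reduction of
Chen–Huang–Kanj–Xia (Lemma 2.2 / Thm. 5.5) is established on the word RAM
(`liberalSparseKSATInRAMTime_of_kCliqueInTimeNLittleOK_holds`, `CliqueETHLiberalReduction.lean`).
[cite: ImpagliazzoPaturiZaneJCSS2001, §2 (sparse instances, parameter m)] -/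
def LiberalSparseKSATInRAMTime (k c : ℕ) (δ : ℝ) : Prop :=
  ∃ (M : Program) (k' : ℕ) (C : ℝ), M.IsDeterministic ∧ M.IsOracleFree ∧
    ∀ φ : Complexity.CNF ℕ, Complexity.CNF.IsWidthLE k φ →
      Complexity.CNF.numClauses φ ≤ c * Complexity.CNF.numVars φ →
      ∀ W : ℕ, k' * (Complexity.CNF.numVars φ + inputWidth (encodeCNFWords φ)) ≤ W →
        ∃ out ∈ CNFSAT.Good φ,
          OutputsWithin M W noOracle zeroCoins (encodeCNFWords φ) out
            ⌊C * (2 : ℝ) ^ (δ * (Complexity.CNF.numVars φ : ℝ)) + C⌋₊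

/-- `LiberalSparseKSATInRAMTime` is monotone in the exponent. [folklore] -/
theorem LiberalSparseKSATInRAMTime.mono {k c : ℕ} {δ δ' : ℝ}
    (h : LiberalSparseKSATInRAMTime k c δ) (hδ : δ ≤ δ') : LiberalSparseKSATInRAMTime k c δ' := by
  obtain ⟨M, k', C, hdet, hof, hM⟩ := h
  refine ⟨M, k', max C 0, hdet, hof, fun φ hw hc W hW => ?_⟩
  obtain ⟨out, hout, hrun⟩ := hM φ hw hc W hW
  refine ⟨out, hout, hrun.mono (Nat.floor_le_floor ?_)⟩
  set n : ℕ := Complexity.CNF.numVars φ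
  have h0 : (0 : ℝ) ≤ max C 0 := le_max_right _ _
  have h1 : (0 : ℝ) ≤ (2 : ℝ) ^ (δ * (n : ℝ)) := by positivity
  have h2 : (2 : ℝ) ^ (δ * (n : ℝ)) ≤ (2 : ℝ) ^ (δ' * (n : ℝ)) :=
    Real.rpow_le_rpow_of_exponent_le (by norm_num)
      (mul_le_mul_of_nonneg_right hδ (Nat.cast_nonneg _))
  calc C * (2 : ℝ) ^ (δ * (n : ℝ)) + C ≤ max C 0 * (2 : ℝ) ^ (δ * (n : ℝ)) + max C 0 :=
        add_le_add (mul_le_mul_of_nonneg_right (le_max_left _ _) h1) (le_max_left _ _)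
    _ ≤ max C 0 * (2 : ℝ) ^ (δ' * (n : ℝ)) + max C 0 := by gcongr

/-- The liberal form gives back `SparseKSATInRAMTime` (restrict to `Nodup` instances, take the
least admissible word size). [folklore] -/
theorem LiberalSparseKSATInRAMTime.sparse {k c : ℕ} {δ : ℝ}
    (h : LiberalSparseKSATInRAMTime k c δ) : SparseKSATInRAMTime k c δ := by
  obtain ⟨M, k', C, hdet, hof, hM⟩ := h
  refine ⟨M, k', C, hdet, hof, fun φ hφ => ?_⟩
  obtain ⟨hw, -⟩ := φ.2
  exact hM φ.1 hw hφ _ le_rfl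

/-! ### Sparse `k`-SAT on multi-stack Turing machines -/

/-- The sparse `k`-CNFs of density `c`: at most `c · n` clauses (`n = numVars`).
[cite: ImpagliazzoPaturiZaneJCSS2001, §2 (sparse instances, parameter m)] -/
abbrev SparseKCNF (k c : ℕ) : Type :=
  {φ : KCNF k // φ.clauses.length ≤ c * φ.numVars}

/-- `SparseKSATInExpTime k c δ`: **sparse** `k`-SAT on multi-stack Turing machines — some
`Turing.FinTM2` started on the encoding of any `k`-CNF `φ` on `n` variables with at most `c · n`
clauses halts with the correct answer `decide φ.Satisfiable` within `T(n, L) = O(2^{δ n} poly(L))`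
steps; nothing is required on denser inputs. This is Wave0's `KSATInExpTime k δ` restricted to
sparse instances, the Turing-machine companion of `SparseKSATInRAMTime`.
[cite: ImpagliazzoPaturiZaneJCSS2001, §2 (sparse instances, parameter m)] -/
def SparseKSATInExpTime (k c : ℕ) (δ : ℝ) : Prop :=
  ∃ T : ℕ → ℕ → ℕ, IsExpPolyBound δ T ∧
    ComputesInTime (fun φ : SparseKCNF k c => φ.1.encode) encodeBool
      (fun φ => decide φ.1.Satisfiable) fun φ => T φ.1.numVars φ.1.encode.length

/-- A `k`-SAT machine is a sparse-`k`-SAT machine, for every density. [folklore] -/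
theorem KSATInExpTime.sparse {k : ℕ} {δ : ℝ} (h : KSATInExpTime k δ) (c : ℕ) :
    SparseKSATInExpTime k c δ := by
  obtain ⟨T, hT, M, hM⟩ := h
  exact ⟨T, hT, M, fun φ => hM φ.1⟩

/-- **The change of machine model (named fact).** For `k ≥ 2`: if for every density `c'` and
every `δ > 0` some deterministic word-RAM program decides the sparse `k`-CNFs of density `c'` in
time `O(2^{δ n})` (`LiberalSparseKSATInRAMTime`), then for every density `c` and every `δ > 0` some
multi-stack Turing machine decides the sparse `k`-CNFs of density `c` in time `2^{δ n} · poly(L)`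
(`SparseKSATInExpTime`). Folklore simulation of random-access machines by multitape Turing
machines with polynomial overhead (Cook–Reckhow, JCSS 7 (1973), §2; Korte–Vygen, *Combinatorial
Optimization* (2002), §15.2, p. 341: the memory is kept on a tape as the list of the pairs
(address, contents) in binary and every RAM operation is a scan of that list, `O(l²)` steps for a
list of length `l`; here `l = O((T + L) · (n + L))` for the time-`T` word RAM with `O(n + L)`-bit
words, so a run costs `O(T² · poly(n, L))` Turing-machine steps, and `poly(n) = 2^{o(n)}`): the
machine parses Wave0's `Γ'`-encoding of `φ`, answers directly if `φ` has an empty clause or no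
variable, and otherwise
hands the clause list, padded with the tautological clause `x_{n-1} ∨ ¬x_{n-1}` (so that it has
exactly `n` variables in the sense of `CNF.numVars` and density `≤ c + 1`; this is where `k ≥ 2` is
used), to the simulated RAM program of density `c + 1` and exponent `δ/3`. See also VVW, ICM 2018,
§2 (robustness of ETH-type hypotheses under the machine model).
[cite: KorteVygen2002, §15.2 (p. 341)] [cite: CookReckhow1973, §2] [cite: VassilevskaWilliamsICM2018, §2] -/
def sparseKSATInExpTime_of_liberalSparseKSATInRAMTime : Prop :=
  ∀ k c : ℕ, 2 ≤ k → (∀ (c' : ℕ) (δ : ℝ), 0 < δ → LiberalSparseKSATInRAMTime k c' δ) →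
    ∀ δ : ℝ, 0 < δ → SparseKSATInExpTime k c δ

/-! ### Corollary 2 of Impagliazzo–Paturi–Zane on Turing machines: `k`-SAT from sparse `k`-SAT -/

/-- Powers are dominated by every exponential: `(n + 1)^a ≤ C · 2^{ε n}`. [folklore] -/
theorem exists_pow_le_two_rpow (a : ℕ) {ε : ℝ} (hε : 0 < ε) :
    ∃ C : ℝ, 0 ≤ C ∧ ∀ n : ℕ, ((n : ℝ) + 1) ^ a ≤ C * (2 : ℝ) ^ (ε * n) := by
  set r : ℝ := (2 : ℝ) ^ ε with hr
  have hr1 : 1 < r := Real.one_lt_rpow (by norm_num) hε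
  have hr0 : 0 < r := by linarith
  have ht := tendsto_pow_const_div_const_pow_of_one_lt a hr1
  obtain ⟨B, hB⟩ := ht.bddAbove_range
  have hBn : ∀ m : ℕ, (m : ℝ) ^ a / r ^ m ≤ B := fun m => hB ⟨m, rfl⟩
  have hB0 : 0 ≤ B := le_trans (by positivity) (hBn 0)
  refine ⟨B * r, by positivity, fun n => ?_⟩
  have hrn : 0 < r ^ (n + 1) := pow_pos hr0 _
  have h1 : ((n : ℝ) + 1) ^ a ≤ B * r ^ (n + 1) := by
    have := hBn (n + 1)
    rw [div_le_iff₀ hrn] at this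
    push_cast at this
    exact this
  have h2 : (2 : ℝ) ^ (ε * n) = r ^ n := by rw [hr, Real.rpow_mul_natCast (by norm_num)]
  rw [h2]
  calc ((n : ℝ) + 1) ^ a ≤ B * r ^ (n + 1) := h1
    _ = B * r * r ^ n := by ring

/-- Forgetting the proofs of a `pmap Subtype.mk` gives back the list. [folklore] -/
theorem map_val_pmap_mk {α : Type*} {p : α → Prop} (l : List α) (hl : ∀ a ∈ l, p a) :
    (l.pmap Subtype.mk hl).map Subtype.val = l := by
  induction l with
  | nil => rfl
  | cons a l ih => simpa using ih fun b hb => hl b (List.mem_cons_of_mem a hb)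

namespace KCNF

variable {k : ℕ}

/-- `KCNF.eval` in terms of literals. [folklore] -/
theorem eval_eq_true_iff_forall_exists (φ : KCNF k) (v : ℕ → Bool) :
    φ.eval v = true ↔ ∀ c ∈ φ.clauses, ∃ l ∈ c, v l.1 = l.2 := by
  simp [KCNF.eval, List.all_eq_true, List.any_eq_true]

/-- `KCNF.eval` only depends on the values of the `numVars` variables. [folklore] -/
theorem eval_congr_numVars (φ : KCNF k) {v w : ℕ → Bool} (h : ∀ i < φ.numVars, v i = w i) :
    φ.eval v = φ.eval w := by
  rw [Bool.eq_iff_iff, eval_eq_true_iff_forall_exists, eval_eq_true_iff_forall_exists]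
  refine forall₂_congr fun c hc => exists_congr fun l => and_congr_right fun hl => ?_
  rw [h l.1 (φ.fst_lt_numVars c hc l hl)]

/-- Satisfiability of a `KCNF` in terms of total assignments `ℕ → Bool`. [folklore] -/
theorem satisfiable_iff_exists_eval (φ : KCNF k) :
    φ.Satisfiable ↔ ∃ v : ℕ → Bool, φ.eval v = true := by
  constructor
  · rintro ⟨v, hv⟩
    exact ⟨_, hv⟩
  · rintro ⟨v, hv⟩
    refine ⟨fun i => v i.1, ?_⟩
    rw [← hv]
    exact φ.eval_congr_numVars fun i hi => by simp [hi]

/-- The encoding length of a `k`-CNF with at most `C · n` clauses is `O_{C,k}(n²)`: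
`L + 1 ≤ (2 + 2C + 3Ck) (n + 1)²`. [folklore] -/
theorem length_encode_succ_le_of_sparse {C : ℕ} (ψ : KCNF k)
    (hC : ψ.clauses.length ≤ C * ψ.numVars) :
    ψ.encode.length + 1 ≤ (2 + 2 * C + 3 * C * k) * (ψ.numVars + 1) ^ 2 := by
  set n := ψ.numVars with hn
  have hsize : ∀ i, i ≤ n → (encodeNat i).length ≤ n := fun i hi => by
    rw [Complexity.TM2Pass.length_encodeNat_eq_size]
    exact (Nat.size_le_size hi).trans (Nat.size_le.2 Nat.lt_two_pow_self)
  have hlitlen : ∀ l : ℕ × Bool, (encodeLiteral l).length = (encodeNat l.1).length + 2 := fun l => by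
    simp [encodeLiteral]
  have hcllen : ∀ c : List (ℕ × Bool),
      (encodeClause c).length = (c.map fun l => (encodeLiteral l).length).sum + 2 := fun c => by
    simp [encodeClause, List.length_flatMap]
  have hlit : ∀ c ∈ ψ.clauses, ∀ l ∈ c, (encodeLiteral l).length ≤ n + 2 := by
    intro c hc l hl
    have := hsize l.1 (ψ.fst_lt_numVars c hc l hl).le
    rw [hlitlen]; omega
  have hcl : ∀ c ∈ ψ.clauses, (encodeClause c).length ≤ k * (n + 2) + 2 := by
    intro c hc
    have h1 : (c.map fun l => (encodeLiteral l).length).sum ≤ c.length * (n + 2) := by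
      have := List.sum_le_card_nsmul (c.map fun l => (encodeLiteral l).length) (n + 2) (by
        intro x hx
        obtain ⟨l, hl, rfl⟩ := List.mem_map.1 hx
        exact hlit c hc l hl)
      simpa using this
    have h2 : c.length * (n + 2) ≤ k * (n + 2) := Nat.mul_le_mul_right _ (ψ.length_le c hc)
    rw [hcllen]; omega
  have hsum : (ψ.clauses.flatMap encodeClause).length ≤ C * n * (k * (n + 2) + 2) := by
    have h1 : (ψ.clauses.map fun c => (encodeClause c).length).sum ≤
        ψ.clauses.length * (k * (n + 2) + 2) := by
      have := List.sum_le_card_nsmul (ψ.clauses.map fun c => (encodeClause c).length)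
        (k * (n + 2) + 2) (by
          intro x hx
          obtain ⟨c, hc, rfl⟩ := List.mem_map.1 hx
          exact hcl c hc)
      simpa using this
    have h2 : (ψ.clauses.flatMap encodeClause).length =
        (ψ.clauses.map fun c => (encodeClause c).length).sum := by
      simp [List.length_flatMap]
    rw [h2]
    exact h1.trans (Nat.mul_le_mul_right _ hC)
  have hlen : ψ.encode.length = (encodeNat n).length + 1 + (ψ.clauses.flatMap encodeClause).length := by
    simp only [encode, List.length_append, List.length_map, List.length_cons]
    rw [← hn]
    omega
  have h0 : (encodeNat n).length ≤ n := hsize n le_rfl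
  rw [hlen]
  have key : n + 2 + C * n * (k * (n + 2) + 2) ≤ (2 + 2 * C + 3 * C * k) * (n + 1) ^ 2 := by
    have e : (2 + 2 * C + 3 * C * k) * (n + 1) ^ 2 =
        n + 2 + C * n * (k * (n + 2) + 2) +
          (2 * n * n + 3 * n + 2 * C * n * n + 2 * C * n + 2 * C + 2 * C * k * n * n +
            4 * C * k * n + 3 * C * k) := by ring
    rw [e]; exact Nat.le_add_right _ _
  omega

end KCNF

/-- **`k`-SAT from sparse `k`-SAT on Turing machines (Impagliazzo–Paturi–Zane, Cor. 2, with the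
sparsification lemma as hypothesis).** If for every density `c` and every `δ > 0` the sparse
`k`-CNFs of density `c` are decidable in time `2^{δ n} · poly(L)`, then `k`-SAT is decidable in time
`2^{δ n} · poly(L)` for every `δ > 0`: sparsify with `ε = δ/3` (at most `2^{δ n/3}` formulas on the
same `n` variables with `≤ C n` clauses each, in time `2^{δ n/3} poly(L)`), decide each produced
formula with the density-`C` machine of exponent `δ/3` (its input has length `O_{C,k}(n²)`, and
`poly(n) ≤ const · 2^{δ n/3}`), and accept iff some produced formula is accepted
(`computesInTime_any`). [cite: ImpagliazzoPaturiZaneJCSS2001, Cor. 2 (with Cor. 1)] -/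
theorem kSATInExpTime_of_sparseKSATInExpTime (hS : sparsification) {k : ℕ}
    (h : ∀ (c : ℕ) (δ : ℝ), 0 < δ → SparseKSATInExpTime k c δ) (δ : ℝ) (hδ : 0 < δ) :
    KSATInExpTime k δ := by
  classical
  set ε : ℝ := δ / 3 with hεdef
  have hε : 0 < ε := by positivity
  obtain ⟨C, F, T_F, hF, hT_F, hM_F⟩ := hS k ε hε
  obtain ⟨T_D, hT_D, hM_D⟩ := h C ε hε
  -- the produced formulas are sparse of density `C`
  have hsp : ∀ φ, ∀ ψ ∈ F φ, ψ.clauses.length ≤ C * ψ.numVars := fun φ ψ hψ => by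
    obtain ⟨hn, hc⟩ := (hF φ).2.1 ψ hψ
    rwa [hn]
  set F' : KCNF k → List (SparseKCNF k C) := fun φ => (F φ).pmap Subtype.mk (hsp φ) with hF'def
  have hF'map : ∀ φ, (F' φ).map Subtype.val = F φ := fun φ => by
    rw [hF'def]
    exact map_val_pmap_mk (F φ) (hsp φ)
  have hM_F' : ComputesInTime KCNF.encode
      (fun l : List (SparseKCNF k C) => l.flatMap fun b => b.1.encode ++ [Γ'.blank]) F'
      fun φ => T_F φ.numVars φ.encode.length := by
    obtain ⟨M, hM⟩ := hM_F
    refine ⟨M, fun φ => ?_⟩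
    have e : (F' φ).flatMap (fun b => b.1.encode ++ [Γ'.blank]) = KCNF.encodeList (F φ) := by
      rw [KCNF.encodeList_eq, ← hF'map φ, List.flatMap_map]
    dsimp only
    rw [e]
    exact hM φ
  obtain ⟨c₅, hM₅⟩ := computesInTime_any (sep := Γ'.blank) (F := F')
    (Q := fun ψ : SparseKCNF k C => decide ψ.1.Satisfiable) (fun ψ => ψ.1.blank_not_mem_encode)
    hM_F' hM_D
  -- correctness
  have hcorr : ∀ φ : KCNF k,
      ((F' φ).any fun ψ => decide ψ.1.Satisfiable) = decide φ.Satisfiable := by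
    intro φ
    have e : ((F' φ).any fun ψ => decide ψ.1.Satisfiable) =
        (F φ).any fun ψ => decide ψ.Satisfiable := by
      rw [← hF'map φ, List.any_map]; rfl
    rw [e, Bool.eq_iff_iff, List.any_eq_true, decide_eq_true_iff]
    simp only [decide_eq_true_iff]
    rw [KCNF.satisfiable_iff_exists_eval]
    constructor
    · rintro ⟨ψ, hψ, hsat⟩
      obtain ⟨v, hv⟩ := (KCNF.satisfiable_iff_exists_eval ψ).1 hsat
      exact ⟨v, ((hF φ).2.2 v).2 ⟨ψ, hψ, hv⟩⟩
    · rintro ⟨v, hv⟩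
      obtain ⟨ψ, hψ, hψv⟩ := ((hF φ).2.2 v).1 hv
      exact ⟨ψ, hψ, (KCNF.satisfiable_iff_exists_eval ψ).2 ⟨v, hψv⟩⟩
  refine KCNF.kSATInExpTime_of_isExpPolyDom ?_ (hM₅.congr_fun hcorr)
  -- the time bound
  obtain ⟨c_D, hc_D⟩ := hT_D
  obtain ⟨C₂, hC₂0, hC₂⟩ := exists_pow_le_two_rpow (2 * c_D + 2) hε
  set A : ℝ := ((2 + 2 * C + 3 * C * k : ℕ) : ℝ) with hA
  have hA0 : (0 : ℝ) ≤ A := by rw [hA]; exact Nat.cast_nonneg _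
  have hA1 : (1 : ℝ) ≤ A := by rw [hA]; exact_mod_cast (show 1 ≤ 2 + 2 * C + 3 * C * k by omega)
  -- per-entry bound
  set g : SparseKCNF k C → ℕ := fun b => T_D b.1.numVars b.1.encode.length + b.1.encode.length + 1
    with hgdef
  have hentry : ∀ φ : KCNF k, ∀ b ∈ F' φ,
      (g b : ℝ) ≤ (c_D + 1) * A ^ (c_D + 1) * C₂ * (2 : ℝ) ^ (2 * ε * φ.numVars) := by
    intro φ b hb
    have hbF : b.1 ∈ F φ := by rw [← hF'map φ]; exact List.mem_map_of_mem hb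
    obtain ⟨hn, -⟩ := (hF φ).2.1 b.1 hbF
    set n := φ.numVars
    have hL : ((b.1.encode.length : ℝ) + 1) ≤ A * ((n : ℝ) + 1) ^ 2 := by
      have := KCNF.length_encode_succ_le_of_sparse b.1 b.2
      rw [hn] at this
      rw [hA]; exact_mod_cast this
    have hL0 : (0 : ℝ) ≤ (b.1.encode.length : ℝ) + 1 := by positivity
    have hT : (T_D b.1.numVars b.1.encode.length : ℝ) ≤
        c_D * (2 : ℝ) ^ (ε * n) * ((b.1.encode.length : ℝ) + 1) ^ c_D := by
      have := hc_D b.1.numVars b.1.encode.length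
      rw [hn] at this ⊢
      exact this
    have hpow : ((b.1.encode.length : ℝ) + 1) ^ c_D ≤ A ^ c_D * ((n : ℝ) + 1) ^ (2 * c_D) := by
      calc ((b.1.encode.length : ℝ) + 1) ^ c_D ≤ (A * ((n : ℝ) + 1) ^ 2) ^ c_D :=
            pow_le_pow_left₀ hL0 hL _
        _ = A ^ c_D * ((n : ℝ) + 1) ^ (2 * c_D) := by rw [mul_pow, ← pow_mul]
    have hn1 : (1 : ℝ) ≤ (n : ℝ) + 1 := by simp
    have hP : ((n : ℝ) + 1) ^ (2 * c_D) ≤ C₂ * (2 : ℝ) ^ (ε * n) :=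
      (pow_le_pow_right₀ hn1 (by omega)).trans (hC₂ n)
    have hP2 : ((n : ℝ) + 1) ^ 2 ≤ C₂ * (2 : ℝ) ^ (ε * n) :=
      (pow_le_pow_right₀ hn1 (by omega)).trans (hC₂ n)
    have e2 : (2 : ℝ) ^ (ε * n) * (2 : ℝ) ^ (ε * n) = (2 : ℝ) ^ (2 * ε * n) := by
      rw [← Real.rpow_add (by norm_num)]; ring_nf
    have hE1 : (1 : ℝ) ≤ (2 : ℝ) ^ (ε * n) := Real.one_le_rpow (by norm_num) (by positivity)
    have hAc : A ^ c_D ≤ A ^ (c_D + 1) := pow_le_pow_right₀ hA1 (Nat.le_succ _)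
    have hA' : A ≤ A ^ (c_D + 1) := by
      calc A = A ^ 1 := (pow_one A).symm
        _ ≤ A ^ (c_D + 1) := pow_le_pow_right₀ hA1 (by omega)
    have hg : (g b : ℝ) = T_D b.1.numVars b.1.encode.length + ((b.1.encode.length : ℝ) + 1) := by
      rw [hgdef]; push_cast; ring
    rw [hg]
    calc (T_D b.1.numVars b.1.encode.length : ℝ) + ((b.1.encode.length : ℝ) + 1)
        ≤ c_D * (2 : ℝ) ^ (ε * n) * ((b.1.encode.length : ℝ) + 1) ^ c_D +
            A * ((n : ℝ) + 1) ^ 2 := add_le_add hT hL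
      _ ≤ c_D * (2 : ℝ) ^ (ε * n) * (A ^ c_D * ((n : ℝ) + 1) ^ (2 * c_D)) +
            A * ((n : ℝ) + 1) ^ 2 := by gcongr
      _ ≤ c_D * (2 : ℝ) ^ (ε * n) * (A ^ (c_D + 1) * (C₂ * (2 : ℝ) ^ (ε * n))) +
            A ^ (c_D + 1) * (C₂ * (2 : ℝ) ^ (ε * n)) := by gcongr
      _ ≤ c_D * (2 : ℝ) ^ (ε * n) * (A ^ (c_D + 1) * (C₂ * (2 : ℝ) ^ (ε * n))) +
            A ^ (c_D + 1) * (C₂ * (2 : ℝ) ^ (ε * n)) * (2 : ℝ) ^ (ε * n) := by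
          have h0 : (0 : ℝ) ≤ A ^ (c_D + 1) * (C₂ * (2 : ℝ) ^ (ε * n)) := by positivity
          nlinarith
      _ = (c_D + 1) * A ^ (c_D + 1) * C₂ * ((2 : ℝ) ^ (ε * n) * (2 : ℝ) ^ (ε * n)) := by ring
      _ = (c_D + 1) * A ^ (c_D + 1) * C₂ * (2 : ℝ) ^ (2 * ε * n) := by rw [e2]
  -- the sum over the produced list
  have hsum : KCNF.IsExpPolyDom δ fun φ : KCNF k => ((((F' φ).map g).sum : ℕ) : ℝ) := by
    refine ⟨⌈(c_D + 1) * A ^ (c_D + 1) * C₂⌉₊, 0, fun φ => ?_⟩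
    set n := φ.numVars
    set K : ℝ := (c_D + 1) * A ^ (c_D + 1) * C₂ with hK
    have hK0 : 0 ≤ K := by positivity
    have h1 : ((((F' φ).map g).sum : ℕ) : ℝ) ≤ ((F' φ).length : ℝ) * (K * (2 : ℝ) ^ (2 * ε * n)) := by
      have := List.sum_le_card_nsmul (((F' φ).map g).map (fun x : ℕ => (x : ℝ)))
        (K * (2 : ℝ) ^ (2 * ε * n)) (by
          intro x hx
          obtain ⟨y, hy, rfl⟩ := List.mem_map.1 hx
          obtain ⟨b, hb, rfl⟩ := List.mem_map.1 hy
          exact hentry φ b hb)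
      rw [Nat.cast_list_sum]
      simpa [nsmul_eq_mul] using this
    have hlen : ((F' φ).length : ℝ) ≤ (2 : ℝ) ^ (ε * n) := by
      have := (hF φ).1
      rw [← hF'map φ, List.length_map] at this
      exact this
    have e3 : (2 : ℝ) ^ (ε * n) * (2 : ℝ) ^ (2 * ε * n) = (2 : ℝ) ^ (δ * n) := by
      rw [← Real.rpow_add (by norm_num)]; congr 1; rw [hεdef]; ring
    calc ((((F' φ).map g).sum : ℕ) : ℝ) ≤ ((F' φ).length : ℝ) * (K * (2 : ℝ) ^ (2 * ε * n)) := h1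
      _ ≤ (2 : ℝ) ^ (ε * n) * (K * (2 : ℝ) ^ (2 * ε * n)) := by gcongr
      _ = K * ((2 : ℝ) ^ (ε * n) * (2 : ℝ) ^ (2 * ε * n)) := by ring
      _ = K * (2 : ℝ) ^ (δ * n) := by rw [e3]
      _ ≤ ⌈K⌉₊ * (2 : ℝ) ^ (δ * n) := by gcongr; exact Nat.le_ceil K
      _ = ((⌈K⌉₊ : ℕ) : ℝ) * (2 : ℝ) ^ (δ * n) * (((φ.encode.length : ℝ) + 1) ^ 0) := by
          rw [pow_zero, mul_one]
  have hεδ : ε ≤ δ := by rw [hεdef]; linarith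
  have hdom : KCNF.IsExpPolyDom δ fun φ : KCNF k =>
      ((c₅ * (T_F φ.numVars φ.encode.length + ((F' φ).map g).sum + φ.encode.length + 1) : ℕ) : ℝ) := by
    have h1 : KCNF.IsExpPolyDom δ fun φ : KCNF k => (T_F φ.numVars φ.encode.length : ℝ) :=
      (KCNF.IsExpPolyDom.of_isExpPolyBound hT_F).mono hεδ
    have h3 : KCNF.IsExpPolyDom δ fun φ : KCNF k => (φ.encode.length : ℝ) + 1 :=
      KCNF.IsExpPolyDom.length_succ hδ.le
    have := KCNF.IsExpPolyDom.const_mul (c₅ : ℝ) (Nat.cast_nonneg _) ((h1.add hsum).add h3)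
    refine this.of_le fun φ => le_of_eq ?_
    push_cast; ring
  exact hdom

/-! ### Assembly down to the target -/

/-- **Assembly (proved).** Wave0's sparsification lemma, the change of machine model
`sparseKSATInExpTime_of_liberalSparseKSATInRAMTime` and the liberal word-RAM form of the grouping
reduction (`KCliqueInTimeNLittleOK → ∀ c, ∀ δ > 0, LiberalSparseKSATInRAMTime 3 c δ`, which is
`liberalSparseKSATInRAMTime_of_kCliqueInTimeNLittleOK_holds` of `CliqueETHLiberalReduction.lean`)
imply `not_kClique_inTimeInst_of_eth` verbatim: under ETH pick `δ > 0` with `¬ KSATInExpTime 3 δ`;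
an `f(k) · N^{o(k)}` clique algorithm gives sparse 3-SAT on the word RAM for all densities and all
exponents, hence (machine model) on Turing machines, hence (`kSATInExpTime_of_sparseKSATInExpTime`)
`KSATInExpTime 3 δ`. [cite: ChenHuangKanjXiaJCSS2006, Thm. 5.5] -/
theorem not_kClique_inTimeInst_of_eth_of_tm (hS : sparsification)
    (hB : sparseKSATInExpTime_of_liberalSparseKSATInRAMTime)
    (hb : KCliqueInTimeNLittleOK → ∀ (c : ℕ) (δ : ℝ), 0 < δ → LiberalSparseKSATInRAMTime 3 c δ) :
    not_kClique_inTimeInst_of_eth := by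
  rintro ⟨δ, hδ, hnot⟩ hclique
  exact hnot (kSATInExpTime_of_sparseKSATInExpTime hS
    (fun c δ' hδ' => hB 3 c (by norm_num) (hb hclique) δ' hδ') δ hδ)

/-- The same assembly read as a refutation of ETH: sparsification, the change of machine model,
the liberal grouping reduction and an `f(k) · N^{o(k)}` word-RAM clique algorithm put 3-SAT in
`TIME(2^{δ n} poly(L))` for every `δ > 0`. [cite: ChenHuangKanjXiaJCSS2006, Thm. 5.5] -/
theorem kSATInExpTime_three_of_kCliqueInTimeNLittleOK (hS : sparsification)
    (hB : sparseKSATInExpTime_of_liberalSparseKSATInRAMTime)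
    (hb : KCliqueInTimeNLittleOK → ∀ (c : ℕ) (δ : ℝ), 0 < δ → LiberalSparseKSATInRAMTime 3 c δ)
    (h : KCliqueInTimeNLittleOK) (δ : ℝ) (hδ : 0 < δ) : KSATInExpTime 3 δ :=
  kSATInExpTime_of_sparseKSATInExpTime hS (fun c δ' hδ' => hB 3 c (by norm_num) (hb h) δ' hδ') δ hδ

end Literature.Computability.FineGrained
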